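import Summits.BirchSwinnertonDyer.BirchSwinnertonDyer.Theorems.ClassRecordThreeCornerAtThreeShimuraFamilyKummerPlaces
import Summits.BirchSwinnertonDyer.BirchSwinnertonDyer.Theorems.ClassRecordThreeCornerAtThreeShimuraFamilyLabels
import HarnessLib

/-!
# INVARIANCE `[P_m] ∈ (E(K[m]) ⊆ E(K̄) / p^M)^{Γ_K}` of the derived point of a GENERALISED Kolyvagin datum from the label (B4) at Gross depth `M`
# — the producer `hP` of this seat's (P2) assembly `Koly.familyLevelSupply_of_memberships`, for EVERY datum of a labelled family
# (cell `bsd-stepL`, seat `bsd-stepL-tam3-p1` g13, owner of 19109's line; `--supports stmt-BirchSwinnertonDyer-19109 --as helper`)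

HONEST FRAMING. Theorems only (no definition, no named fact, no `sorry`); CONDITIONAL on the label (B4) (datum form ∕ `LabelsAt`); nothing about
any CM ∕ Heegner point is constructed; no stub closes; 0 classes move (T7); BSD is not proved by any of this. Credit: corner3-p2 g8 — the tower
form is ll. 100–185 of its `kolyvaginClass_familyData_mem_selmerLocalKer` (p600152) EXPORTED (the level-data package `exists_levelData_familyData`,
(B4) ∧ Gross (3.3) `p^M ∣ a_ℓ`, `p^M ∣ ℓ + 1`, and lit-ty's `map_kolyvaginPoint_mem_invPoints`), nothing more.
WHAT.
* `toGeomPoints_derivedPoint_familyData_mem_invPoints` (tower form): for a tower `d : (m ∣ n) → KolyvaginFamilyData W K ι m` over a square-free `n`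
  on Gross–Kolyvagin primes of depth `M ≥ 1` carrying (B4) in datum form, `[P_m]` is `Γ_K`-invariant modulo `p^M · E(K[m])` at every `m ∣ n`
  (Gross 1991 §4 after (4.4): `(σ_ℓ − 1) D_ℓ = ℓ + 1 − Tr_ℓ`).
* `toGeomPoints_derivedPoint_mem_invPoints_of_labelsAt` (∀-datum form): the same for ANY datum `d₀` at `n` with `d₀.y = ys n` of a family carrying
  `LabelsAt` — by completing `d₀` to a tower with arbitrary data at the proper divisors (`exists_familyData_y_eq`) and reading (B4) in datum form
  off the labels (`familyLabels_of_labelsAt`).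
* `Koly.familyInvariance_of_labelsAt`: the producer `hP` of `Koly.familyLevelSupply_of_memberships` VERBATIM (`∀ n d, d.y = ys n → Squarefree n →
  Gross–Kolyvagin primes → ∀ j, 1 ≤ j → j ≤ M_Gross(n) → [P_n] ∈ invPoints Γ_K (E(K[n])) (p^j)`).
References (locators only): [cite: GrossLMS1991, §3 Prop. 3.7 (1), (3.3), §4 (4.1)–(4.4)] [cite: McCallumLMS1991, §4 (4.2)–(4.4)].
presearch: not applicable (export of a tree proof); `lean search 'derivedPoint_familyData_mem_invPoints'` → none.
Design: `K : Type`. Axioms: `propext`, `Classical.choice`, `Quot.sound`.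
-/

set_option autoImplicit false

noncomputable section

open scoped Classical

namespace Summit.BirchSwinnertonDyer.BirchSwinnertonDyer.Theorems.ShimuraWalk

open WeierstrassCurve Field NumberField IsDedekindDomain Finset
  Literature.NumberTheory.EllipticCurves Literature.NumberTheory.GaloisRepresentations
  Literature.NumberTheory.EllipticCurves.KolyvaginCocycle
  Literature.NumberTheory.EllipticCurves.KolyvaginEuler
  Literature.NumberTheory.EllipticCurves.RingClassField
  Literature.NumberTheory.EllipticCurves.ModularForms
  Summit.BirchSwinnertonDyer.Rank1Residual.X11b Summit.BirchSwinnertonDyer.Rank1Residual.X11b.Three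
  Summit.BirchSwinnertonDyer.Rank1Residual.X11b.Three.GrossBadPlace Summit.BirchSwinnertonDyer.Rank1Residual.X11b.KolyvaginHloc
  Summit.BirchSwinnertonDyer.Rank1Residual.JET
  Summit.BirchSwinnertonDyer.BirchSwinnertonDyer.Theorems

variable {K : Type} [Field K] [NumberField K] {W : WeierstrassCurve ℚ}

set_option maxHeartbeats 800000 in
/-- **`[P_m] ∈ (E(K[m]) ⊆ E(K̄))^{Γ_K} mod p^M` for a tower of family data carrying (B4), Gross depth `M` at the primes of `n`** (tower form;
corner3-p2's derivation exported). [cite: GrossLMS1991, §3 Prop. 3.7 (1), (3.3), §4 (4.4)] [cite: McCallumLMS1991, §4 (4.3)] -/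
theorem toGeomPoints_derivedPoint_familyData_mem_invPoints {N : ℕ} [NeZero N] [W.IsElliptic] [W.IsGloballyMinimal]
    (hK : IsImaginaryQuadratic K) (ι : K →+* ℂ)
    {p M : ℕ} (hp : p.Prime) (hM : 1 ≤ M) (Dt : ModularParametrizationData W N)
    {n : ℕ} (hn : Squarefree n)
    (hKol : ∀ q ∈ n.primeFactors, IsKolyvaginPrime N W K p q ∧ FrobEqFrobInfty W K (p ^ M) q)
    (d : (m : ℕ) → m ∣ n → KolyvaginFamilyData W K ι m)
    (hB4d : ∀ (m : ℕ) (hm : m ∣ n), ∀ (ℓ : ℕ) (hℓ : ℓ ∈ m.primeFactors)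
      (hle : ringClassField K ι (m / ℓ) ≤ ringClassField K ι m),
      ∑ i ∈ Finset.range (ℓ + 1), pointGalHom W (ringClassField K ι m) ((d m hm).σ ℓ ^ i) (d m hm).y =
        W.frobeniusTrace ℓ • WeierstrassCurve.Affine.Point.map (W' := W)
          ((RingClassField.inclusion ι hle).restrictScalars ℚ)
          (d (m / ℓ) ((Nat.div_dvd_of_dvd (Nat.dvd_of_mem_primeFactors hℓ)).trans hm)).y) :
    ∀ (m : ℕ) (hm : m ∣ n), (d m hm).toGeomPoints (d m hm).derivedPoint ∈
      invPoints (absoluteGaloisGroup K) (d m hm).pointsSubgroup ((p ^ M : ℕ) : ℤ) := by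
  -- adapted from corner3-p2 g8's `kolyvaginClass_familyData_mem_selmerLocalKer` (ll. 100–185), Kummer-specific steps removed
  intro m hm
  haveI : Fact p.Prime := ⟨hp⟩
  have hn0 : n ≠ 0 := Squarefree.ne_zero hn
  have hm0 : m ≠ 0 := ne_zero_of_dvd_ne_zero hn0 hm
  have hinert : ∀ q ∈ n.primeFactors, (Ideal.span {(q : 𝓞 K)}).IsPrime :=
    fun q hq ↦ (hKol q hq).1.2.2.2.2.1
  -- the structures of the level-data package
  letI hcg : ∀ k, CommGroup (ringClassGal ι k) := fun k ↦
    { (inferInstance : Group (ringClassGal ι k)) with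
      mul_comm := fun a b ↦ (KolyvaginH44.isMulCommutative_ringClassGal' hK ι k).is_comm.comm a b }
  letI act : ∀ k, DistribMulAction (ringClassGal ι k)
      ((W.baseChange (ringClassField K ι k)).toAffine.Point) := fun k ↦
    DistribMulAction.compHom _ ((pointGalHom W (ringClassField K ι k)).comp (ringClassGal ι k).subtype)
  -- THE SEAM: level data at every level
  choose σ H hF f y π j e hord hj hπρ hfsec hHρ hdict hjunk using
    fun k ↦ exists_levelData_familyData (W := W) hK ι hn hinert d k
  letI hft : ∀ k, Fintype (ringClassGal ι k ⧸ H k) := hF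
  have hsmul : ∀ (k) (g : ringClassGal ι k) (Q : (W.baseChange (ringClassField K ι k)).toAffine.Point),
      g • Q = pointGalHom W (ringClassField K ι k)
        (g : ringClassField K ι k ≃ₐ[ℚ] ringClassField K ι k) Q := fun _ _ _ ↦ rfl
  set ρ : ∀ k, ringClassGal ι k →* (ringClassField K ι k ≃ₐ[ℚ] ringClassField K ι k) :=
    fun k ↦ (ringClassGal ι k).subtype with hρdef
  have hρ : ∀ k, Function.Injective (ρ k) := fun k ↦ (ringClassGal ι k).subtype_injective
  have hj' : ∀ (k) (g : absoluteGaloisGroup K)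
      (a : (W.baseChange (ringClassField K ι k)).toAffine.Point),
      j k (π k g • a) = g • j k a := fun k g a ↦ by rw [hsmul]; exact hj k g a
  -- the dictionary at the divisor `m`
  obtain ⟨hjm, hym, hσm, hfS, hem, hPm⟩ := hdict m hm
  have hle : ∀ {ℓ : ℕ}, ℓ ∈ m.primeFactors → ringClassField K ι (m / ℓ) ≤ ringClassField K ι m :=
    fun hℓ ↦ ringClassField_mono hK ι (Nat.div_dvd_of_dvd (Nat.dvd_of_mem_primeFactors hℓ)) hm0
  have hm' : ∀ {ℓ : ℕ}, ℓ ∈ m.primeFactors → m / ℓ ∣ n := fun hℓ ↦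
    (Nat.div_dvd_of_dvd (Nat.dvd_of_mem_primeFactors hℓ)).trans hm
  -- (B4) ∧ (3.3): `Tr_ℓ y(m) = a_ℓ • y(m/ℓ)↑` with `p^M ∣ a_ℓ`
  have hrel : ∀ ℓ ∈ m.primeFactors, ∀ (hℓ : ℓ ∈ m.primeFactors),
      grAct ((W.baseChange (ringClassField K ι m)).toAffine.Point) (traceElt (σ m ℓ) ℓ) (y m) =
        W.frobeniusTrace ℓ • WeierstrassCurve.Affine.Point.map (W' := W)
          ((RingClassField.inclusion ι (hle hℓ)).restrictScalars ℚ) (d (m / ℓ) (hm' hℓ)).y := by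
    intro ℓ _ hℓ
    rw [grAct_traceElt, hym, ← hB4d m hm ℓ hℓ (hle hℓ)]
    refine Finset.sum_congr rfl fun i _ ↦ ?_
    rw [hsmul, Subgroup.coe_pow, hσm ℓ hℓ]
  have haℓ : ∀ ℓ ∈ m.primeFactors, ((p ^ M : ℕ) : ℤ) ∣ W.frobeniusTrace ℓ := fun ℓ hℓ ↦
    pow_dvd_frobeniusTrace_of_kolyvaginPrime (K := K) Dt hp hM (hKol ℓ (Nat.primeFactors_mono hm hn0 hℓ)).1
      (hKol ℓ (Nat.primeFactors_mono hm hn0 hℓ)).2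
  have htrA : ∀ ℓ ∈ m.primeFactors,
      grAct ((W.baseChange (ringClassField K ι m)).toAffine.Point) (traceElt (σ m ℓ) ℓ) (y m) ∈
        zsmulRange ((W.baseChange (ringClassField K ι m)).toAffine.Point) ((p ^ M : ℕ) : ℤ) :=
    fun ℓ hℓ ↦ grAct_traceElt_mem_of_eq_smul (hrel ℓ hℓ hℓ) (haℓ ℓ hℓ)
  -- `hgen`, `hdvd`, then the invariance in abstract currency
  have hgen : H m ≤ Subgroup.closure (σ m '' (m.primeFactors : Set ℕ)) :=
    le_closure_of_map_zpowers hK ι (hn.squarefree_of_dvd hm) (σ m) (H m) (ρ m) (hρ m)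
      (fun q hq ↦ by
        rw [MonoidHom.map_zpowers]
        change Subgroup.zpowers (σ m q : ringClassField K ι m ≃ₐ[ℚ] ringClassField K ι m) = _
        rw [hσm q hq]; exact (d m hm).zpowers_σ q hq)
      (hHρ m)
  have hdvd : ∀ ℓ ∈ m.primeFactors, ((p ^ M : ℕ) : ℤ) ∣ ((ℓ + 1 : ℕ) : ℤ) := by
    intro ℓ hℓ
    obtain ⟨hℓK, hℓM⟩ := hKol ℓ (Nat.primeFactors_mono hm hn0 hℓ)
    exact (IsKolyvaginPrime.pow_dvd_add_one W hp hℓK hM hℓM).1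
  have hPt' : j m (kolyvaginPoint (σ m) m.primeFactors (f m) (y m)) ∈
      invPoints (absoluteGaloisGroup K) (j m).range ((p ^ M : ℕ) : ℤ) :=
    map_kolyvaginPoint_mem_invPoints (hfsec m) hgen (hord m) hdvd htrA (π m) (j m) (hj' m)
  -- the abstract point IS the datum's `P_m`
  have hP : j m (kolyvaginPoint (σ m) m.primeFactors (f m) (y m)) =
      (d m hm).toGeomPoints (d m hm).derivedPoint := by rw [hjm, hPm]
  have h := hPt'
  rw [hP, hjm] at h
  exact h

/-- **`[P_n] ∈ (E(K[n]) ⊆ E(K̄))^{Γ_K}` mod `p^M` for ANY datum `d₀` at `n` with `d₀.y = ys n` of a family carrying `LabelsAt`**, Gross depth `M`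
at the primes of `n` (tower-around-`d₀` + `familyLabels_of_labelsAt`). [cite: GrossLMS1991, §4 (4.4), Prop. 3.7 (1)] -/
theorem toGeomPoints_derivedPoint_mem_invPoints_of_labelsAt {N : ℕ} [NeZero N] [W.IsElliptic] [W.IsGloballyMinimal]
    (hK : IsImaginaryQuadratic K) (ι : K →+* ℂ)
    {p M : ℕ} (hp : p.Prime) (hM : 1 ≤ M) (Dt : ModularParametrizationData W N)
    {n : ℕ} (hn : Squarefree n)
    (hKol : ∀ q ∈ n.primeFactors, IsKolyvaginPrime N W K p q ∧ FrobEqFrobInfty W K (p ^ M) q)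
    (ys : (m : ℕ) → (W.baseChange (ringClassField K ι m)).toAffine.Point)
    {yK : (W.baseChange K).toAffine.Point} {ε : ℤ} (hL : LabelsAt W N K ι yK ys ε)
    (d₀ : KolyvaginFamilyData W K ι n) (hy : d₀.y = ys n) :
    d₀.toGeomPoints d₀.derivedPoint ∈ invPoints (absoluteGaloisGroup K) d₀.pointsSubgroup ((p ^ M : ℕ) : ℤ) := by
  have hn0 : n ≠ 0 := hn.ne_zero
  have hguard : ∀ q ∈ n.primeFactors, ¬ q ∣ N ∧ (Ideal.span {(q : 𝓞 K)}).IsPrime :=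
    fun q hq ↦ ⟨(hKol q hq).1.2.1, (hKol q hq).1.2.2.2.2.1⟩
  -- a tower around `d₀`: `d₀` at `n`, any datum of the family at the proper divisors
  have hex : ∀ m : ℕ, m ∣ n → ∃ dm : KolyvaginFamilyData W K ι m, dm.y = ys m ∧ ∀ h : m = n, h ▸ dm = d₀ := by
    intro m hm
    by_cases h : m = n
    · subst h
      exact ⟨d₀, hy, fun _ ↦ rfl⟩
    · obtain ⟨dm, hdm⟩ := exists_familyData_y_eq (W := W) hK ι (hn.squarefree_of_dvd hm)
        (fun q hq ↦ (hguard q (Nat.primeFactors_mono hm hn0 hq)).2) ys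
      exact ⟨dm, hdm, fun h' ↦ absurd h' h⟩
  choose d hdy hdd using hex
  have hdn : d n dvd_rfl = d₀ := hdd n dvd_rfl rfl
  obtain ⟨hB4d, -, -⟩ := familyLabels_of_labelsAt (W := W) hn hguard ys hL d hdy
  have h := toGeomPoints_derivedPoint_familyData_mem_invPoints hK ι hp hM Dt hn hKol d hB4d n dvd_rfl
  rwa [hdn] at h

end Summit.BirchSwinnertonDyer.BirchSwinnertonDyer.Theorems.ShimuraWalk

namespace Summit.BirchSwinnertonDyer.Rank1Residual.X11b.Three.Koly

open WeierstrassCurve Field NumberField Literature.NumberTheory.EllipticCurves Literature.NumberTheory.GaloisRepresentations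
  Literature.NumberTheory.EllipticCurves.KolyvaginCocycle Literature.NumberTheory.EllipticCurves.ModularForms
  Summit.BirchSwinnertonDyer.Rank1Residual.JET Summit.BirchSwinnertonDyer.BirchSwinnertonDyer.Theorems
open Summit.BirchSwinnertonDyer.BirchSwinnertonDyer.Theorems.ShimuraWalk (frobLevelIndex natCast_le_frobLevelIndex_iff LabelsAt)

variable {K : Type} [Field K] [NumberField K] (W : WeierstrassCurve ℚ) [W.IsElliptic] [W.IsGloballyMinimal]

/-- **The producer `hP` of `Koly.familyLevelSupply_of_memberships`, VERBATIM its hypothesis shape, from `LabelsAt`** (and a modular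
parametrisation, for Gross (3.3) `p^j ∣ a_ℓ`). [cite: GrossLMS1991, §3 (3.3), §4 (4.4)] -/
theorem familyInvariance_of_labelsAt {N : ℕ} [NeZero N] (hK : IsImaginaryQuadratic K) (ι : K →+* ℂ)
    {p : ℕ} (hp : p.Prime) (Dt : ModularParametrizationData W N)
    (ys : (m : ℕ) → (W.baseChange (ringClassField K ι m)).toAffine.Point)
    {yK : (W.baseChange K).toAffine.Point} {ε : ℤ} (hL : LabelsAt W N K ι yK ys ε) :
    ∀ (n : ℕ) (d : KolyvaginFamilyData W K ι n), d.y = ys n → Squarefree n →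
      (∀ q ∈ n.primeFactors, IsKolyvaginPrime N W K p q) →
      ∀ j : ℕ, 1 ≤ j → (j : ℕ∞) ≤ frobLevelIndex W K p n →
        d.toGeomPoints d.derivedPoint ∈ invPoints (absoluteGaloisGroup K) d.pointsSubgroup ((p ^ j : ℕ) : ℤ) :=
  fun _ d hy hn hKP j hj hjM ↦
    ShimuraWalk.toGeomPoints_derivedPoint_mem_invPoints_of_labelsAt hK ι hp hj Dt hn
      (fun q hq ↦ ⟨hKP q hq, (natCast_le_frobLevelIndex_iff hKP j).mp hjM q hq⟩) ys hL d hy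

end Summit.BirchSwinnertonDyer.Rank1Residual.X11b.Three.Koly

end
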